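import Summits.AnomalousDissipation.AnomalousDissipation.Theorems.SolenoidalFractalHomogenisationLagrangianStepSidebandDefs
import HarnessLib

/-!
# K1L_D `LagrangianRenormalisationStepDesign` (stmt-AnomalousDissipation-27980), `stub_D1_V0` (V0 = clause (ii) of
# `WCrossing.D1ExactFamily`): the FINITE-ξ sideband objects — class frequencies `ℓ + n·z`, the box-truncated sideband vector of a weak
# solution, the finite-ξ augmented truncated generator, unit sources, class-transversal projection and the box tail
# (shared definitions; reviewed; `--supports stmt-AnomalousDissipation-27980 --as helper`)

Summits-side DEFINITIONS file of route `SolenoidalFractalHomogenisation` (prover seat `ad-k1l-cellLawV-w1` g6), the finite-ξ companion of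
`…SidebandDefs` (tenure D26-3, brick T1) needed by brick **T4** of the V0 architecture `Cruxes/LagrangianRenormalisationStep/Lines/onelevel-V0-exact-family.md`
§4 as refined by FINDING F-w1g6-1 (cell STATUS 2026-08-29T01:48Z: the reference must be CLASS-TRANSVERSAL, `z_ref := P^{(ξ)}[Σⱼ ξⱼ Nⱼ x]`, and the residual's
energy inequality keeps the full symbol form).  Definitions with bodies and unfolding lemmas only; no theorems of substance, no named facts, no sorry.

THE OBJECTS.  A weak solution `u` of the flat tensor cell problem (`Torus.IsWeakTensorPassiveVectorOn 0 T 𝔹 (W₁.cell n) F u`, `𝔹 = (1/n²)•𝔸` in (V))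
with a datum in the class of the slow mode `ℓ` lives on the frequencies `k_z = ℓ + n·z`, `z ∈ ℤ³` (`classFreq n ℓ z`); its chain
(`CellChain.hasDerivAt_modeRep`) reads `y_z' = −4π² P_{k_z} T_{𝔹ᵀ}(k_z) y_z − Σⱼ linkCoeffⱼ(k_z,t) • P_{k_z}(αⱼ y_{z−mⱼ} + ᾱⱼ y_{z+mⱼ})`.
* `classFreq n ℓ z = ℓ + n·z`; `xiCoeff W₁ n ℓ j = (êⱼ·ℓ)/n` (the real scalar `ξⱼ` with `linkCoeffⱼ(ℓ + n·mⱼ, t) = ξⱼ · 2πi·envⱼ(t)`);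
* `sbVec W₁ n 𝔹 F u ℓ R t : Space R` — the box-truncated sideband vector `z ↦ modeRep(k_z, t)`, `z ∈ box R`;
* `genXComp / genX W₁ n ℓ 𝔹 γ₁ R t : Space R →L[ℂ] Space R` — the finite-ξ AUGMENTED truncated generator: the formula of `Sideband.gen` with every
  projection / symbol / link coefficient taken at `k_z` instead of `z` and the tensor `𝔹` (so `genX W₁ 1 0 𝔸 = gen W₁ 𝔸`, `genXComp_one_zero`); on
  class-transversal states it IS the true chain restricted to the box (brick T4a);
* `sourceXComp / sourceX W₁ n ℓ R j t : ℂ³ →L[ℂ] Space R` — the unit source of slot `j` with the class projections `P_{k_{±mⱼ}}` (the true coefficient of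
  `ξⱼ·y_0` in the sideband equations);
* `projX n ℓ R : Space R →L[ℂ] Space R` — componentwise `P_{k_z}` (makes the ξ = 0 reference class-transversal);
* `tailVec W₁ n 𝔹 F u ℓ R t : Space R` — the links of box modes to class modes OUTSIDE `box R ∪ {0}` (truncation tail, controlled by the dissipation
  integral at `|z| ≥ R − max|mⱼ|`).
NOT a proof of anything; rung F-D1.A0 infrastructure.  AD is not proved.
-/

set_option linter.dupNamespace false

noncomputable section

namespace Summit.AnomalousDissipation.AnomalousDissipation.Theorems.SolenoidalFractalHomogenisation.LagrangianStep.Sideband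

open Set MeasureTheory Complex UnitAddTorus
open scoped InnerProductSpace
open Literature.Analysis Literature.Analysis.FunctionSpaces Literature.Analysis.FunctionSpaces.Torus
open Literature.Analysis.FluidPDE Literature.Analysis.FluidPDE.Torus Literature.Analysis.FluidPDE.LatticeShear
open Summit.AnomalousDissipation.AnomalousDissipation.Theorems.SolenoidalFractalHomogenisation.LagrangianStep.CellChain (linkCoeff modeRep)

variable {k₀ : ℕ}

/-! ## §1 Class frequencies and the slow–fast coupling scalar -/

/-- **The frequency of the class point `z` over the slow mode `ℓ` at cell number `n`**: `k_z = ℓ + n·z`. [cite: MajdaKramer1999, §2.2.1.3] -/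
def classFreq (n : ℕ) (ℓ z : Fin 3 → ℤ) : Fin 3 → ℤ := fun i => ℓ i + (n : ℤ) * z i

/-- Unfolding `classFreq`. [cite: MajdaKramer1999, §2.2.1.3] -/
theorem classFreq_apply (n : ℕ) (ℓ z : Fin 3 → ℤ) (i : Fin 3) : classFreq n ℓ z i = ℓ i + (n : ℤ) * z i := rfl

/-- At `ℓ = 0`, `n = 1` the class frequency is the lattice point itself. [cite: MajdaKramer1999, §2.2.1.3] -/
theorem classFreq_one_zero (z : Fin 3 → ℤ) : classFreq 1 0 z = z := by
  funext i; simp [classFreq]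

/-- The class of `0` is the slow mode. [cite: MajdaKramer1999, §2.2.1.3] -/
theorem classFreq_zero (n : ℕ) (ℓ : Fin 3 → ℤ) : classFreq n ℓ 0 = ℓ := by
  funext i; simp [classFreq]

/-- Chain neighbours are class neighbours: `k_{z − m} = k_z − K`, `K i = m i · n`. [cite: MeshalkinSinai1961, pp. 1700–1705] -/
theorem classFreq_sub (n : ℕ) (ℓ z m : Fin 3 → ℤ) : classFreq n ℓ (z - m) = classFreq n ℓ z - fun i => m i * (n : ℤ) := by
  funext i; simp [classFreq]; ring

/-- Chain neighbours are class neighbours: `k_{z + m} = k_z + K`. [cite: MeshalkinSinai1961, pp. 1700–1705] -/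
theorem classFreq_add (n : ℕ) (ℓ z m : Fin 3 → ℤ) : classFreq n ℓ (z + m) = classFreq n ℓ z + fun i => m i * (n : ℤ) := by
  funext i; simp [classFreq]; ring

/-- **The slow–fast coupling scalar of slot `j`**: `ξⱼ = (êⱼ·ℓ)/n` (real; `|ξⱼ| ≤ |ℓ|/n`). [cite: MajdaKramer1999, §2.2.1.3] -/
def xiCoeff (W₁ : LatticeWord k₀) (n : ℕ) (ℓ : Fin 3 → ℤ) (j : Fin k₀) : ℝ := (∑ a, (W₁.phase j).e a * (ℓ a : ℝ)) / (n : ℝ)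

/-- Unfolding `xiCoeff`. [cite: MajdaKramer1999, §2.2.1.3] -/
theorem xiCoeff_def (W₁ : LatticeWord k₀) (n : ℕ) (ℓ : Fin 3 → ℤ) (j : Fin k₀) :
    xiCoeff W₁ n ℓ j = (∑ a, (W₁.phase j).e a * (ℓ a : ℝ)) / (n : ℝ) := rfl

/-! ## §2 The box-truncated sideband vector of a field -/

/-- **The box-truncated sideband vector** of the field `u` (datum `F`) in the class of `ℓ`: `z ↦ modeRep(ℓ + n·z, t)`, `z ∈ box R`.
[cite: MajdaKramer1999, §2.2.1.3 (cell problem (49))] [cite: Temam1984, Ch. III §1.1] -/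
def sbVec (W₁ : LatticeWord k₀) (n : ℕ) (𝔹 : Torus.Visc4 (Fin 3)) (F : UnitAddTorus (Fin 3) → EuclideanSpace ℝ (Fin 3))
    (u : ℝ → UnitAddTorus (Fin 3) → EuclideanSpace ℝ (Fin 3)) (ℓ : Fin 3 → ℤ) (R : ℕ) (t : ℝ) : Space R :=
  WithLp.toLp 2 fun z : box R => modeRep W₁ n 𝔹 F u (classFreq n ℓ z.1) t

/-- Components of `sbVec`. [cite: Temam1984, Ch. III §1.1] -/
theorem sbVec_apply (W₁ : LatticeWord k₀) (n : ℕ) (𝔹 : Torus.Visc4 (Fin 3)) (F : UnitAddTorus (Fin 3) → EuclideanSpace ℝ (Fin 3))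
    (u : ℝ → UnitAddTorus (Fin 3) → EuclideanSpace ℝ (Fin 3)) (ℓ : Fin 3 → ℤ) (R : ℕ) (t : ℝ) (z : box R) :
    sbVec W₁ n 𝔹 F u ℓ R t z = modeRep W₁ n 𝔹 F u (classFreq n ℓ z.1) t := rfl

/-! ## §3 The finite-ξ augmented truncated generator, the unit sources, the class projection -/

/-- **The `z`-component of the finite-ξ augmented truncated generator**:
`y ↦ −4π² P_{k_z} T_{𝔹ᵀ}(k_z) P_{k_z} y_z − γ₁ (y_z − P_{k_z} y_z) − Σⱼ linkCoeffⱼ(k_z,t) • P_{k_z} (αⱼ P_{k_{z−mⱼ}} y_{z−mⱼ} + ᾱⱼ P_{k_{z+mⱼ}} y_{z+mⱼ})`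
(`k_w = classFreq n ℓ w`; neighbours outside the box read as `0`). [cite: MajdaKramer1999, §2.2.1.3 (cell problem (49))] [cite: MeshalkinSinai1961, pp. 1700–1705] -/
def genXComp (W₁ : LatticeWord k₀) (n : ℕ) (ℓ : Fin 3 → ℤ) (𝔹 : Torus.Visc4 (Fin 3)) (γ₁ : ℝ) (R : ℕ) (t : ℝ) (z : box R) :
    Space R →L[ℂ] EuclideanSpace ℂ (Fin 3) :=
  -((((4 * Real.pi ^ 2 : ℝ) : ℂ)) • ((transversalProj (classFreq n ℓ z.1)).comp ((symbTL (Torus.majorTranspose 𝔹) (classFreq n ℓ z.1)).comp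
      ((transversalProj (classFreq n ℓ z.1)).comp (coordL R z.1))))) -
    ((γ₁ : ℝ) : ℂ) • (coordL R z.1 - (transversalProj (classFreq n ℓ z.1)).comp (coordL R z.1)) -
    ∑ j, linkCoeff W₁ n (classFreq n ℓ z.1) j t • ((transversalProj (classFreq n ℓ z.1)).comp
      (slotAmp W₁ j • ((transversalProj (classFreq n ℓ (z.1 - (W₁.phase j).m))).comp (coordL R (z.1 - (W₁.phase j).m))) +
        starRingEnd ℂ (slotAmp W₁ j) • ((transversalProj (classFreq n ℓ (z.1 + (W₁.phase j).m))).comp (coordL R (z.1 + (W₁.phase j).m)))))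

/-- **The finite-ξ augmented truncated generator** `genX … t : Space R →L[ℂ] Space R` (components `genXComp`). [cite: MajdaKramer1999, §2.2.1.3] -/
def genX (W₁ : LatticeWord k₀) (n : ℕ) (ℓ : Fin 3 → ℤ) (𝔹 : Torus.Visc4 (Fin 3)) (γ₁ : ℝ) (R : ℕ) (t : ℝ) : Space R →L[ℂ] Space R :=
  ((PiLp.continuousLinearEquiv 2 ℂ (fun _ : box R => EuclideanSpace ℂ (Fin 3))).symm : (box R → EuclideanSpace ℂ (Fin 3)) →L[ℂ] Space R).comp
    (ContinuousLinearMap.pi fun z => genXComp W₁ n ℓ 𝔹 γ₁ R t z)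

/-- Components of `genX`. [cite: MajdaKramer1999, §2.2.1.3] -/
theorem genX_apply (W₁ : LatticeWord k₀) (n : ℕ) (ℓ : Fin 3 → ℤ) (𝔹 : Torus.Visc4 (Fin 3)) (γ₁ : ℝ) (R : ℕ) (t : ℝ) (y : Space R) (z : box R) :
    genX W₁ n ℓ 𝔹 γ₁ R t y z = genXComp W₁ n ℓ 𝔹 γ₁ R t z y := by
  simp [genX]

/-- **At `ℓ = 0`, `n = 1` the finite-ξ generator is the `ξ = 0` generator of `…SidebandDefs`** (the one inside `psiStar`), componentwise.
[cite: MajdaKramer1999, §2.2.1.3] -/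
theorem genXComp_one_zero (W₁ : LatticeWord k₀) (𝔸 : Torus.Visc4 (Fin 3)) (γ₁ : ℝ) (R : ℕ) (t : ℝ) (z : box R) :
    genXComp W₁ 1 0 𝔸 γ₁ R t z = genComp W₁ 𝔸 γ₁ R t z := by
  have h : ∀ w : Fin 3 → ℤ, classFreq 1 0 w = w := classFreq_one_zero
  unfold genXComp genComp
  rw [h]
  congr 1
  refine Finset.sum_congr rfl fun j _ => ?_
  rw [h, h]

/-- `genX W₁ 1 0 𝔸 = gen W₁ 𝔸`. [cite: MajdaKramer1999, §2.2.1.3] -/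
theorem genX_one_zero (W₁ : LatticeWord k₀) (𝔸 : Torus.Visc4 (Fin 3)) (γ₁ : ℝ) (R : ℕ) (t : ℝ) :
    genX W₁ 1 0 𝔸 γ₁ R t = gen W₁ 𝔸 γ₁ R t := by
  ext y z
  rw [genX_apply, gen_apply, genXComp_one_zero]

/-- **The `z`-component of the finite-ξ unit source of slot `j`**: `−2πi·envⱼ(t)·αⱼ·P_{k_{mⱼ}} v` at `z = mⱼ`, `−2πi·envⱼ(t)·ᾱⱼ·P_{k_{−mⱼ}} v` at
`z = −mⱼ`, else `0` (the true coefficient of `ξⱼ·y_0` in the sideband equations). [cite: MajdaKramer1999, §2.2.1.3 (cell problem (49), source term)] -/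
def sourceXComp (W₁ : LatticeWord k₀) (n : ℕ) (ℓ : Fin 3 → ℤ) (R : ℕ) (j : Fin k₀) (t : ℝ) (z : box R) :
    EuclideanSpace ℂ (Fin 3) →L[ℂ] EuclideanSpace ℂ (Fin 3) :=
  (if z.1 = (W₁.phase j).m then (-(2 * Real.pi * Complex.I * ((slotEnvelope W₁ j t : ℝ) : ℂ) * slotAmp W₁ j)) • transversalProj (classFreq n ℓ z.1)
    else 0) +
  (if z.1 = -(W₁.phase j).m then
      (-(2 * Real.pi * Complex.I * ((slotEnvelope W₁ j t : ℝ) : ℂ) * starRingEnd ℂ (slotAmp W₁ j))) • transversalProj (classFreq n ℓ z.1)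
    else 0)

/-- **The finite-ξ unit source of slot `j`** `sourceX … j t : ℂ³ →L[ℂ] Space R`. [cite: MajdaKramer1999, §2.2.1.3] -/
def sourceX (W₁ : LatticeWord k₀) (n : ℕ) (ℓ : Fin 3 → ℤ) (R : ℕ) (j : Fin k₀) (t : ℝ) : EuclideanSpace ℂ (Fin 3) →L[ℂ] Space R :=
  ((PiLp.continuousLinearEquiv 2 ℂ (fun _ : box R => EuclideanSpace ℂ (Fin 3))).symm : (box R → EuclideanSpace ℂ (Fin 3)) →L[ℂ] Space R).comp
    (ContinuousLinearMap.pi fun z => sourceXComp W₁ n ℓ R j t z)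

/-- Components of `sourceX`. [cite: MajdaKramer1999, §2.2.1.3] -/
theorem sourceX_apply (W₁ : LatticeWord k₀) (n : ℕ) (ℓ : Fin 3 → ℤ) (R : ℕ) (j : Fin k₀) (t : ℝ) (v : EuclideanSpace ℂ (Fin 3)) (z : box R) :
    sourceX W₁ n ℓ R j t v z = sourceXComp W₁ n ℓ R j t z v := by
  simp [sourceX]

/-- **The class-transversal projection** `projX n ℓ R : Space R →L[ℂ] Space R`, `(projX y)_z = P_{k_z} y_z`. [cite: Temam1984, Ch. III §1.1] -/
def projX (n : ℕ) (ℓ : Fin 3 → ℤ) (R : ℕ) : Space R →L[ℂ] Space R :=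
  ((PiLp.continuousLinearEquiv 2 ℂ (fun _ : box R => EuclideanSpace ℂ (Fin 3))).symm : (box R → EuclideanSpace ℂ (Fin 3)) →L[ℂ] Space R).comp
    (ContinuousLinearMap.pi fun z => (transversalProj (classFreq n ℓ z.1)).comp (coordL R z.1))

/-- Components of `projX`. [cite: Temam1984, Ch. III §1.1] -/
theorem projX_apply (n : ℕ) (ℓ : Fin 3 → ℤ) (R : ℕ) (y : Space R) (z : box R) :
    projX n ℓ R y z = transversalProj (classFreq n ℓ z.1) (y z) := by
  simp [projX, coordL_apply_of_mem z.2]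

/-! ## §4 The truncation tail -/

/-- **The truncation tail** of the box-truncated chain of `u` in the class of `ℓ`:
`(tailVec)_z = −Σⱼ linkCoeffⱼ(k_z,t) • P_{k_z}(αⱼ·[z−mⱼ ∉ box ∪ {0}]·y_{z−mⱼ} + ᾱⱼ·[z+mⱼ ∉ box ∪ {0}]·y_{z+mⱼ})` (the links of box modes to
class modes OUTSIDE the box other than the slow mode). [cite: MajdaKramer1999, §2.2.1.3] -/
def tailVec (W₁ : LatticeWord k₀) (n : ℕ) (𝔹 : Torus.Visc4 (Fin 3)) (F : UnitAddTorus (Fin 3) → EuclideanSpace ℝ (Fin 3))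
    (u : ℝ → UnitAddTorus (Fin 3) → EuclideanSpace ℝ (Fin 3)) (ℓ : Fin 3 → ℤ) (R : ℕ) (t : ℝ) : Space R :=
  open Classical in
  WithLp.toLp 2 fun z : box R =>
    -∑ j, linkCoeff W₁ n (classFreq n ℓ z.1) j t • transversalProj (classFreq n ℓ z.1)
      (slotAmp W₁ j • (if (z.1 - (W₁.phase j).m ∉ box R ∧ z.1 - (W₁.phase j).m ≠ 0) then modeRep W₁ n 𝔹 F u (classFreq n ℓ (z.1 - (W₁.phase j).m)) t else 0) +
        starRingEnd ℂ (slotAmp W₁ j) •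
          (if (z.1 + (W₁.phase j).m ∉ box R ∧ z.1 + (W₁.phase j).m ≠ 0) then modeRep W₁ n 𝔹 F u (classFreq n ℓ (z.1 + (W₁.phase j).m)) t else 0))

open Classical in
/-- Components of `tailVec`. [cite: MajdaKramer1999, §2.2.1.3] -/
theorem tailVec_apply (W₁ : LatticeWord k₀) (n : ℕ) (𝔹 : Torus.Visc4 (Fin 3)) (F : UnitAddTorus (Fin 3) → EuclideanSpace ℝ (Fin 3))
    (u : ℝ → UnitAddTorus (Fin 3) → EuclideanSpace ℝ (Fin 3)) (ℓ : Fin 3 → ℤ) (R : ℕ) (t : ℝ) (z : box R) :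
    tailVec W₁ n 𝔹 F u ℓ R t z =
      -∑ j, linkCoeff W₁ n (classFreq n ℓ z.1) j t • transversalProj (classFreq n ℓ z.1)
        (slotAmp W₁ j • (if (z.1 - (W₁.phase j).m ∉ box R ∧ z.1 - (W₁.phase j).m ≠ 0) then modeRep W₁ n 𝔹 F u (classFreq n ℓ (z.1 - (W₁.phase j).m)) t else 0) +
          starRingEnd ℂ (slotAmp W₁ j) •
            (if (z.1 + (W₁.phase j).m ∉ box R ∧ z.1 + (W₁.phase j).m ≠ 0) then modeRep W₁ n 𝔹 F u (classFreq n ℓ (z.1 + (W₁.phase j).m)) t else 0)) := rfl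

end Summit.AnomalousDissipation.AnomalousDissipation.Theorems.SolenoidalFractalHomogenisation.LagrangianStep.Sideband

end
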